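import Summits.QuantumFields.BalabanUV.Beta.D1BFx.RoadEndBFxSpineDictMeanS
import Summits.QuantumFields.BalabanUV.Beta.D1BFx.RoadEndBFxDictPointwiseS

/-!
# `BalabanUV.Beta.D1BFx.RoadEndBFxDictPointwiseMeanS` — road «BF-x» for binder row D1, slot (K): **THE MEAN LANE's DICTIONARY ROW IN POINTWISE CURRENCY**
# («DICT-PTW-MEAN», the mean-grading twin of the OWNER d1-p2-g14's «DICT-PTW» `RoadEndBFxDictPointwiseS`): my (E) `RoadEndBFxSpineDictMeanS` (p305688) with its ONE
# (K)-side row — the CESÀRO dictionary defect `hdictM` — REPLACED by the OWNER's POINTWISE dictionary `hptw` (letter for letter the uniform lane's) + unit-class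
# moment rows on named rest kernels whose read-out slack need only be `o(m)` (`hRuM`)

HONEST DEPENDENCY (cell records, verbatim): «continuum YM on T⁴ ⇐ BetaPertH ∧ nine spine estimates (0/9 proved); BetaPertH ⇐ (D1) ∧ (D4) ∧
CAP+tail; G-an2-4 gates asym, D1 and NE2/3/4.»  HONEST FRAMING (cell contract, verbatim): «discharging `BetaPertH` makes Bałaban's UV stability
UNCONDITIONAL — a real constructive-QFT result; it is NOT the continuum limit and NOT the Clay problem.»  THIS MODULE DISCHARGES NOTHING of the
wall: [folklore] two `Tendsto` one-liners on real sequences, ONE use of the OWNER's `RoadEndBFxDictPointwiseS.secondMoment_of_pointwise` ∕ `absMoment₂_gluon_of_prop12`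
∕ `two_le_pow_scale` and of `GhostKernelComplete.absMoment₂_PghQ` BY NAME, and composition BY NAME of my (E) §1∕§2∕§3.  No `def`, no `def … : Prop`, nothing cited,
0 sorry.  Root-level binders of row D1 (hW ∕ hR-sockets ∕ hSX-socket ∕ D1Tel ∕ D1Rep) — 0 discharged; (K) NOT closed (`hptw` + `hMR` + `hRuM` ARE the (K) debt,
displayed); NOT D1, NOT `BetaPertH`, NOT continuum, NOT Clay.

ABSOLUTE RULE (cell charter, verbatim): «No internally-minted statement may enter as a cited fact. Every hypothesis is either kernel-proved in
this package or a verbatim quotation of a PUBLISHED theorem with page reference. The manuscript(s) under audit are NOT citable for their own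
disputed steps — they are the thing under adjudication; programme-internal (2001/route/tribunal) claims are never citable.»

WHY.  The OWNER's «DICT-PTW» moved the uniform lane's (K) row `hdict` (a statement about (1.22) second MOMENTS) into the currency in which the (A1)–(A3)
dictionary is being proved — ONE identity of KERNELS, POINTWISE in the separation `z`, per one-shot scale `n = Lc^m` (`hptw`), plus `AbsMoment₂` rows and a
UNIFORM read-out slack `|M₂[Rk u n] − Ru u n| ≤ CU′ u`, `Σ_u CU′ u ≤ U₁` on finitely many named rest kernels.  The MEAN lane's (K) row is the weaker Cesàro
defect `hdictM` (an `o(m)` statement, paid for by the displayed all-scales bound `hall` of row G-an2-4); by the OWNER's `secondMoment_of_pointwise` the defect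
at `m ≥ 1` IS `Σ_u (M₂[Rk u (Lc^m)] − Ru u (Lc^m))`, so the mean lane takes THE SAME `hptw` and `hMR` and only asks the read-out slack to be `o(m)`
word by word (`hRuM`) — implied by the OWNER's uniform rows WITHOUT `hU₁` (`hRuM_of_uniform`), as `hdictM` itself is implied by `hdict` (`hdictM_of_hdict`).

CONTENT.
* §1 [folklore, real sequences] `tendsto_div_natCast_of_abs_le` (`|g m| ≤ C` for `m ≥ 1` ⊢ `g m ∕ m → 0`), `tendsto_div_natCast_of_eq_sum`
  (`f m = Σ_u g u m` for `m ≥ 1` and each `g u m ∕ m → 0` ⊢ `f m ∕ m → 0`).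
* §2 [folklore] **`hdictM_of_pointwise`**: THE MEAN LANE's ROW `hdictM` of (E) VERBATIM ⟸ `(Rk) (hptw) (hMR) (hRuM)` (+ `hL ha h12 h126` and the END's slot-table
  sockets `hδW hE hJ hΛ hR hQ`, which make the gluon ∕ ghost terms well-typed (1.22)-kernels exactly as in the OWNER's §2); bridges **`hRuM_of_uniform`**
  (the OWNER's `hRu` ⊢ `hRuM`) and **`hdictM_of_hdict`** (the uniform lane's `hdict` ⊢ the mean lane's `hdictM`).
* §3 [folklore] **`d1Drift_BFx_mean_of_D1Sum_ptw_sbpS`** (the mean-lane «END-ii» END ⟹ `D1Drift Lc Js N μ ν`) and **`d1Rep_BFx_mean_of_D1Tel_ptw_sbpS`** (⟹ the spine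
  root's `D1Rep Lc Jc N μ ν a SL k` at its own binder names `hW`∕`hRfl`∕`htel`) — (E) §1∕§3 with the binder `hdictM` REPLACED IN PLACE by `(Rk) (hptw) (hMR) (hRuM)`,
  every other binder BYTE-IDENTICAL (generated from the TREE bytes of p305688 by script); bodies = ONE call of the (E) theorem with `hdictM_of_pointwise …` in the
  slot.  ((E) §2, the `D1Rep`-over-`D1Sum` form, is not twinned — the 400-line rule; it is (E) §2 at `hdictM_of_pointwise …` for any caller.)
Unit `b2b-balaban-beta-d1-formalise-leaf-01` (gen 19), D1 formalisation swarm leaf prover 01, road «BF-x» MEAN lane; INTENT 1 «DICT-PTW-MEAN» (journal l.36486).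
-/

noncomputable section

open Finset Filter Topology
open Literature.Probability.LatticeModels (annulus)
open scoped BigOperators
open Literature.MathematicalPhysics.QuantumFieldTheory
open Literature.MathematicalPhysics.QuantumFieldTheory.Balaban1983to89
open Literature.MathematicalPhysics.QuantumFieldTheory.Balaban1983to89.Beta
open RemainderConstAllScales (AllScalesSeq)
open OneStepResolventKernel (JetData KInv)
open OneStepKernelFamily (TbalOf TshotOf flipK D1Tel D1Rep D1Drift)
open StepDriftWitness (D1Sum d1Sum_iff d1Sum_of_d1Tel d1Rep_iff_d1Drift_of_d1Sum)
open PolarizationSign (WardTransversal AxisReflectionCovariant)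
open InterLevelTransport (onLat)
open BalabanStepJets (lamCoeffOf)
open AveragingHessianKernels (hessFF)
open KernelWard (divV)
open WindowIdentification (fullSum)
open B12Sec2to5 (l1)
open DyadicShell (Pt toReal supNorm)
open ExpKernelCalculus (Site MKer BiLoc shiftK comp)
open DecimatedMomentSummable (AbsMoment₂)
open GhostTable (gFree)
open BubbleTransfer (unitVec)
open DressedMomentNormalisation (resSite)
open Summit.QuantumFields.BalabanUV.Beta.TameKernelCalculus (Spr Loc trK)
open Summit.QuantumFields.BalabanUV.Beta.D1BFx.ReducedKernel (TableR TOfRed)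
open Summit.QuantumFields.BalabanUV.Beta.D1BFx.DressedTadpoleTable (tableRed tadpoleTable)
open Summit.QuantumFields.BalabanUV.Beta.D1BFx.ReducedKernelSandwich (fineHess)
open Summit.QuantumFields.BalabanUV.Beta.D1BFx.FineStencilBF (ffOf)
open Summit.QuantumFields.BalabanUV.Beta.D1BFx.FineStencilBFBalaban (SbfBal)
open Summit.QuantumFields.BalabanUV.Beta.D1BFx.SecondStencilBF (Wbf)
open Summit.QuantumFields.BalabanUV.Beta.D1BFx.GhostKernelComplete (PghQ fineHessGhQ absMoment₂_PghQ)
open Summit.QuantumFields.BalabanUV.Beta.D1BFx.GluonLeg (Ga)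
open Summit.QuantumFields.BalabanUV.Beta.D1BFx.FrozenLegProfile (gfrz)
open Summit.QuantumFields.BalabanUV.Beta.D1BFx.RoadEndBFxSpineDictMeanS (d1Drift_BFx_mean_of_D1Sum_dict_sbpS d1Rep_BFx_mean_of_D1Tel_dict_sbpS)
open Summit.QuantumFields.BalabanUV.Beta.D1BFx.RoadEndBFxDictPointwiseS (secondMoment_of_pointwise absMoment₂_gluon_of_prop12 two_le_pow_scale)
open Summit.QuantumFields.BalabanUV.Beta.D1BFx.FrozenLegTails (nOf MOf hn1)
open VectorTailsLoc (fam kfam)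

namespace Summit.QuantumFields.BalabanUV.Beta.D1BFx.RoadEndBFxDictPointwiseMeanS

/-! ## §1 Generic: Cesàro-null real sequences -/

section Generic

variable {υ : Type*} [Fintype υ]

/-- [folklore] A sequence bounded from `m = 1` on is `o(m)`: `|g m| ≤ C` for `m ≥ 1` ⊢ `g m ∕ m → 0`. -/
theorem tendsto_div_natCast_of_abs_le {g : ℕ → ℝ} {C : ℝ} (hg : ∀ m : ℕ, 1 ≤ m → |g m| ≤ C) :
    Tendsto (fun m : ℕ => g m / (m : ℝ)) atTop (𝓝 0) := by
  refine squeeze_zero_norm' ?_ (tendsto_const_div_atTop_nhds_zero_nat C)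
  filter_upwards [eventually_ge_atTop 1] with m hm
  rw [Real.norm_eq_abs, abs_div, Nat.abs_cast]
  exact div_le_div_of_nonneg_right (hg m hm) (Nat.cast_nonneg m)

/-- [folklore] A finite sum of `o(m)` sequences is `o(m)`: `f m = Σ_u g u m` for `m ≥ 1` and `g u m ∕ m → 0` for every `u` ⊢ `f m ∕ m → 0`. -/
theorem tendsto_div_natCast_of_eq_sum {f : ℕ → ℝ} {g : υ → ℕ → ℝ} (hfg : ∀ m : ℕ, 1 ≤ m → f m = ∑ u, g u m)
    (hg : ∀ u, Tendsto (fun m : ℕ => g u m / (m : ℝ)) atTop (𝓝 0)) : Tendsto (fun m : ℕ => f m / (m : ℝ)) atTop (𝓝 0) := by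
  have h : Tendsto (fun m : ℕ => ∑ u, g u m / (m : ℝ)) atTop (𝓝 0) := by
    simpa using tendsto_finsetSum (Finset.univ : Finset υ) fun u _ => hg u
  refine h.congr' ?_
  filter_upwards [eventually_ge_atTop 1] with m hm
  rw [hfg m hm, Finset.sum_div]

end Generic

/-! ## §2 The mean lane's row `hdictM` from the pointwise dictionary -/

variable {Lc : ℕ} [NeZero Lc] {a N cgh₀ : ℝ} {μ ν : Fin 4} {υ : Type*} [Fintype υ]
  {cE cVH cΛ cR cK cQ cE₂ cJ4 cΛ₂ cR₂ cQ₂ x₀ ωgl ωgh cgh : ℕ → ℝ} {WE WJ WΛ WR WQ : ℕ → TableR} {CE CJ CΛt CRt CQ δW : ℕ → ℝ}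
  {Ru : υ → ℕ → ℝ} {CU : υ → ℝ} {κ θ : ℝ}
  {TΛ WA : ℕ → Fin 4 → Site 4 → Fin 4 → Site 4 → MKer 4 (Fin 4)} {CT δT : ℕ → ℝ}
  {ε : ℕ → ℝ} {X : ℕ → Site 4 → MKer 4 (Fin 4)} {Cx δx : ℕ → ℝ}

omit [NeZero Lc] [Fintype υ] in
/-- [folklore] **THE UNIFORM READ-OUT SLACK IMPLIES THE CESÀRO ONE, WORD BY WORD**: the OWNER's rows `hRu : |M₂[Rk u (Lc^m)] − Ru u (Lc^m)| ≤ CU′ u` (`m ≥ 1`) ⊢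
`hRuM` — NO `hU₁` needed. -/
theorem hRuM_of_uniform (Rk : υ → ℕ → Fin 4 → Fin 4 → Site 4 → ℝ) {CU' : υ → ℝ}
    (hRu : ∀ (u : υ) (m : ℕ), 1 ≤ m → |B12Beta.secondMoment (Rk u (Lc ^ m)) μ ν - Ru u (Lc ^ m)| ≤ CU' u) :
    ∀ u : υ, Tendsto (fun m : ℕ => (B12Beta.secondMoment (Rk u (Lc ^ m)) μ ν - Ru u (Lc ^ m)) / (m : ℝ)) atTop (𝓝 0) :=
  fun u => tendsto_div_natCast_of_abs_le fun m hm => hRu u m hm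

/-- [folklore] **THE UNIFORM LANE's (K) ROW IMPLIES THE MEAN LANE's**: `hdict` of `RoadEndBFxSpineDictS` (`|defect (Lc^m)| ≤ U₁` for `m ≥ 1`) ⊢ `hdictM` of
`RoadEndBFxSpineDictMeanS` (`defect (Lc^m) ∕ m → 0`). -/
theorem hdictM_of_hdict {U₁ : ℝ} (Jc : ∀ m : ℕ, JetData 3 (Lc ^ m))
    (hdict : ∀ m : ℕ, 1 ≤ m → |B12Beta.secondMoment (TshotOf Lc Jc m) μ ν -
      (ωgl (Lc ^ m) * B12Beta.secondMoment (TOfRed (Lc ^ m) a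
          (SbfBal (Lc ^ m) a (cE (Lc ^ m)) (cVH (Lc ^ m)) (cΛ (Lc ^ m)) (cR (Lc ^ m)) (cK (Lc ^ m)) (cQ (Lc ^ m)))
          (tableRed (Lc ^ m) (Wbf (cE₂ (Lc ^ m)) (cJ4 (Lc ^ m)) (cΛ₂ (Lc ^ m)) (cR₂ (Lc ^ m)) (cQ₂ (Lc ^ m))
            (WE (Lc ^ m)) (WJ (Lc ^ m)) (WΛ (Lc ^ m)) (WR (Lc ^ m)) (WQ (Lc ^ m))))) μ ν
        + ωgh (Lc ^ m) * B12Beta.secondMoment (PghQ (Lc ^ m) a (x₀ (Lc ^ m)) (cK (Lc ^ m)) (cQ (Lc ^ m))) μ ν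
        + ∑ u, Ru u (Lc ^ m))| ≤ U₁) :
    Tendsto (fun m : ℕ => (B12Beta.secondMoment (TshotOf Lc Jc m) μ ν -
      (ωgl (Lc ^ m) * B12Beta.secondMoment (TOfRed (Lc ^ m) a
          (SbfBal (Lc ^ m) a (cE (Lc ^ m)) (cVH (Lc ^ m)) (cΛ (Lc ^ m)) (cR (Lc ^ m)) (cK (Lc ^ m)) (cQ (Lc ^ m)))
          (tableRed (Lc ^ m) (Wbf (cE₂ (Lc ^ m)) (cJ4 (Lc ^ m)) (cΛ₂ (Lc ^ m)) (cR₂ (Lc ^ m)) (cQ₂ (Lc ^ m))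
            (WE (Lc ^ m)) (WJ (Lc ^ m)) (WΛ (Lc ^ m)) (WR (Lc ^ m)) (WQ (Lc ^ m))))) μ ν
        + ωgh (Lc ^ m) * B12Beta.secondMoment (PghQ (Lc ^ m) a (x₀ (Lc ^ m)) (cK (Lc ^ m)) (cQ (Lc ^ m))) μ ν
        + ∑ u, Ru u (Lc ^ m))) / (m : ℝ)) atTop (𝓝 0) :=
  tendsto_div_natCast_of_abs_le hdict

/-- [folklore] **«DICT-PTW-MEAN»: THE MEAN LANE's (K) ROW `hdictM` FROM THE POINTWISE DICTIONARY.**  For composite jet data `Jc`, rest-word KERNELS `Rk u n` and, at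
every one-shot scale `n = Lc^m` (`m ≥ 1`): (i) the OWNER's POINTWISE identity `hptw` — the `(μ,ν)` channel of the spine's one-shot kernel `TshotOf Lc Jc m` IS
`ω_gl n·TOfRed n a (SbfBal …) (tableRed n (Wbf …)) + ω_gh n·PghQ n a x₀ cK cQ + Σ_u Rk u n` entry by entry (letter for letter the row of `RoadEndBFxDictPointwiseS`);
(ii) `AbsMoment₂` of the rest kernels' channel; (iii) the read-out slack IN CESÀRO CURRENCY `hRuM : (M₂[Rk u (Lc^m)] − Ru u (Lc^m)) ∕ m → 0` for every rest word —
together with `2 ≤ Lc`, `0 < a`, the printed tables `h12`∕`h126` and the END's slot-table sockets (the gluon and ghost terms are well-typed (1.22)-kernels: the OWNER's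
`absMoment₂_gluon_of_prop12`, `GhostKernelComplete.absMoment₂_PghQ`) — THE ROW `hdictM` of `RoadEndBFxSpineDictMeanS` HOLDS VERBATIM.  Proof: at `m ≥ 1` the defect IS
`Σ_u (M₂[Rk u (Lc^m)] − Ru u (Lc^m))` by the OWNER's `secondMoment_of_pointwise`; then §1.  HONEST: `hptw` is the (A1)–(A3) dictionary in pointwise currency — a
HYPOTHESIS; nothing of it is discharged here. -/
theorem hdictM_of_pointwise (hL : 2 ≤ Lc) (ha : 0 < a)
    (h12 : B5.Prop12Printed (fam nOf hn1 MOf a ha)) (h126 : B5.Kernel126_127Printed (kfam nOf MOf))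
    (Jc : ∀ m : ℕ, JetData 3 (Lc ^ m))
    (hδW : ∀ n, 0 < δW n)
    (hE : ∀ n κ u l u', BiLoc (WE n κ u l u') u u' (CE n) (δW n)) (hJ : ∀ n κ u l u', BiLoc (WJ n κ u l u') u u' (CJ n) (δW n))
    (hΛ : ∀ n κ u l u', BiLoc (WΛ n κ u l u') u u' (CΛt n) (δW n)) (hR : ∀ n κ u l u', BiLoc (WR n κ u l u') u u' (CRt n) (δW n))
    (hQ : ∀ n κ u l u', BiLoc (WQ n κ u l u') u u' (CQ n) (δW n))
    -- THE (K) SLOT IN POINTWISE CURRENCY, MEAN FORM: rest-word kernels `Rk`, the pointwise dictionary `hptw` (the OWNER's, letter for letter), the rest kernels'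
    -- moments, and their read-out slack IN CESÀRO CURRENCY `hRuM`
    (Rk : υ → ℕ → Fin 4 → Fin 4 → Site 4 → ℝ)
    (hptw : ∀ m : ℕ, 1 ≤ m → ∀ z : Site 4, TshotOf Lc Jc m μ ν z =
      ωgl (Lc ^ m) * TOfRed (Lc ^ m) a
          (SbfBal (Lc ^ m) a (cE (Lc ^ m)) (cVH (Lc ^ m)) (cΛ (Lc ^ m)) (cR (Lc ^ m)) (cK (Lc ^ m)) (cQ (Lc ^ m)))
          (tableRed (Lc ^ m) (Wbf (cE₂ (Lc ^ m)) (cJ4 (Lc ^ m)) (cΛ₂ (Lc ^ m)) (cR₂ (Lc ^ m)) (cQ₂ (Lc ^ m))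
            (WE (Lc ^ m)) (WJ (Lc ^ m)) (WΛ (Lc ^ m)) (WR (Lc ^ m)) (WQ (Lc ^ m)))) μ ν z
        + ωgh (Lc ^ m) * PghQ (Lc ^ m) a (x₀ (Lc ^ m)) (cK (Lc ^ m)) (cQ (Lc ^ m)) μ ν z
        + ∑ u, Rk u (Lc ^ m) μ ν z)
    (hMR : ∀ (u : υ) (m : ℕ), 1 ≤ m → AbsMoment₂ (Rk u (Lc ^ m) μ ν))
    (hRuM : ∀ u : υ, Tendsto (fun m : ℕ => (B12Beta.secondMoment (Rk u (Lc ^ m)) μ ν - Ru u (Lc ^ m)) / (m : ℝ)) atTop (𝓝 0)) :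
    Tendsto (fun m : ℕ => (B12Beta.secondMoment (TshotOf Lc Jc m) μ ν -
      (ωgl (Lc ^ m) * B12Beta.secondMoment (TOfRed (Lc ^ m) a
          (SbfBal (Lc ^ m) a (cE (Lc ^ m)) (cVH (Lc ^ m)) (cΛ (Lc ^ m)) (cR (Lc ^ m)) (cK (Lc ^ m)) (cQ (Lc ^ m)))
          (tableRed (Lc ^ m) (Wbf (cE₂ (Lc ^ m)) (cJ4 (Lc ^ m)) (cΛ₂ (Lc ^ m)) (cR₂ (Lc ^ m)) (cQ₂ (Lc ^ m))
            (WE (Lc ^ m)) (WJ (Lc ^ m)) (WΛ (Lc ^ m)) (WR (Lc ^ m)) (WQ (Lc ^ m))))) μ ν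
        + ωgh (Lc ^ m) * B12Beta.secondMoment (PghQ (Lc ^ m) a (x₀ (Lc ^ m)) (cK (Lc ^ m)) (cQ (Lc ^ m))) μ ν
        + ∑ u, Ru u (Lc ^ m))) / (m : ℝ)) atTop (𝓝 0) := by
  classical
  refine tendsto_div_natCast_of_eq_sum (g := fun u m => B12Beta.secondMoment (Rk u (Lc ^ m)) μ ν - Ru u (Lc ^ m)) (fun m hm => ?_) hRuM
  have hn : 2 ≤ Lc ^ m := two_le_pow_scale hL hm
  have hA := absMoment₂_gluon_of_prop12 (cE := cE) (cVH := cVH) (cΛ := cΛ) (cR := cR) (cK := cK) (cQ := cQ) (cE₂ := cE₂) (cJ4 := cJ4)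
    (cΛ₂ := cΛ₂) (cR₂ := cR₂) (cQ₂ := cQ₂) ha h12 h126 hδW hE hJ hΛ hR hQ (Lc ^ m) hn μ ν
  have hB : AbsMoment₂ (PghQ (Lc ^ m) a (x₀ (Lc ^ m)) (cK (Lc ^ m)) (cQ (Lc ^ m)) μ ν) :=
    absMoment₂_PghQ (Lc ^ m) a (x₀ (Lc ^ m)) (cK (Lc ^ m)) (cQ (Lc ^ m)) ha μ ν
  simp only [Finset.sum_sub_distrib]
  rw [secondMoment_of_pointwise (hptw m hm) hA hB (fun u => hMR u m hm)]
  ring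

/-! ## §3 The mean-lane ENDs over the pointwise dictionary -/

/-- [folklore] **ROAD BF-x, THE MEAN-LANE «END-ii» END OVER `D1Sum` + THE DICTIONARY IN POINTWISE CURRENCY** — my (E)
`RoadEndBFxSpineDictMeanS.d1Drift_BFx_mean_of_D1Sum_dict_sbpS` (p305688) with the Cesàro dictionary row `hdictM` REPLACED IN PLACE by the pointwise rows
`(Rk) (hptw) (hMR) (hRuM)` of `hdictM_of_pointwise`; every other binder BYTE-IDENTICAL to (E) §1 (`hall`∕`hθ0`∕`hθ1`, `Jc`, `hsum : D1Sum Lc Js Jc μ ν`, `hωs`+`hs`+`hlam`,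
pins, ray + P13, the five slot-table sockets + covariance + bond swap, `hdiv`, slot E∕R∕Q sockets, (Λ) sockets + (W1)(W2′), (U), `h12`∕`h126` BY NAME — NO leg row,
NO rest-word row, NO Ward row) ⟹ `D1Drift Lc Js N μ ν`.  READING: the mean lane's END displays, about Bałaban's kernels, the SAME pointwise identity per one-shot scale
as the uniform lane's (K1) (`hptw`, the currency of (A1) `KCombineCovStripped.hessKer_transfer_road_cov_stripped`) + unit-class moment rows on named rest kernels whose
read-out slack need only be `o(m)` (`hRuM`).  HONEST: composition BY NAME — ONE call of (E) §1 with `hdictM_of_pointwise …` in the slot; `hptw`∕`hMR`∕`hRuM`, `D1Sum`,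
`hall` and every socket ∕ pin ∕ printed statement are HYPOTHESES (none proved for Bałaban's jets; `Jc` not constructed); 0 root-level binders discharged; (K) NOT
closed; NOT D1, NOT `BetaPertH`, NOT continuum, NOT Clay. -/
theorem d1Drift_BFx_mean_of_D1Sum_ptw_sbpS (Js : ℕ → JetData 3 Lc) (hμν : μ ≠ ν) (hN : N ≠ 0) (hL : 2 ≤ Lc) (hodd : Odd Lc)
    (ha : 0 < a)
    (h12 : B5.Prop12Printed (fam nOf hn1 MOf a ha)) (h126 : B5.Kernel126_127Printed (kfam nOf MOf))
    -- MEAN grading: the displayed all-scales bound on the step coefficients (row G-an2-4) …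
    (hall : AllScalesSeq (fun j => B12Beta.secondMoment (TbalOf Lc Js j) μ ν) κ θ) (hθ0 : 0 ≤ θ) (hθ1 : θ < 1)
    -- … and, for bridge B1 in CESÀRO form: the spine's composite jet data, the Literature's read-out-level telescoping binder, and the CESÀRO one-shot (K)-estimate
    (Jc : ∀ m : ℕ, JetData 3 (Lc ^ m)) (hsum : D1Sum Lc Js Jc μ ν)
    -- THE (K) SLOT IN POINTWISE CURRENCY, MEAN FORM: rest-word kernels `Rk`, the pointwise dictionary `hptw` (the OWNER's, letter for letter), the rest kernels'
    -- moments, and their read-out slack IN CESÀRO CURRENCY `hRuM`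
    (Rk : υ → ℕ → Fin 4 → Fin 4 → Site 4 → ℝ)
    (hptw : ∀ m : ℕ, 1 ≤ m → ∀ z : Site 4, TshotOf Lc Jc m μ ν z =
      ωgl (Lc ^ m) * TOfRed (Lc ^ m) a
          (SbfBal (Lc ^ m) a (cE (Lc ^ m)) (cVH (Lc ^ m)) (cΛ (Lc ^ m)) (cR (Lc ^ m)) (cK (Lc ^ m)) (cQ (Lc ^ m)))
          (tableRed (Lc ^ m) (Wbf (cE₂ (Lc ^ m)) (cJ4 (Lc ^ m)) (cΛ₂ (Lc ^ m)) (cR₂ (Lc ^ m)) (cQ₂ (Lc ^ m))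
            (WE (Lc ^ m)) (WJ (Lc ^ m)) (WΛ (Lc ^ m)) (WR (Lc ^ m)) (WQ (Lc ^ m)))) μ ν z
        + ωgh (Lc ^ m) * PghQ (Lc ^ m) a (x₀ (Lc ^ m)) (cK (Lc ^ m)) (cQ (Lc ^ m)) μ ν z
        + ∑ u, Rk u (Lc ^ m) μ ν z)
    (hMR : ∀ (u : υ) (m : ℕ), 1 ≤ m → AbsMoment₂ (Rk u (Lc ^ m) μ ν))
    (hRuM : ∀ u : υ, Tendsto (fun m : ℕ => (B12Beta.secondMoment (Rk u (Lc ^ m)) μ ν - Ru u (Lc ^ m)) / (m : ℝ)) atTop (𝓝 0))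
    -- the RESCALED loop-weight tie of reading (ii): displayed scalar family `s`, pinned `s n = n⁻²`; the normalisation
    (s : ℕ → ℝ) (hs : ∀ n : ℕ, 2 ≤ n → s n = ((n : ℝ) ^ 2)⁻¹) (hωs : ∀ n : ℕ, 2 ≤ n → ωgh n * (s n * cK n) ^ 2 = -2 * (ωgl n * cE n ^ 2))
    (hlam : ∀ n : ℕ, 2 ≤ n → ωgl n * cE n ^ 2 = 2 * N ^ 2 * (n : ℝ) ^ 8)
    -- pins and the ray (the rows' letters)
    (hcE : ∀ n : ℕ, 2 ≤ n → cE n = (n : ℝ) ^ 4) (hRsgn : ∀ n : ℕ, 2 ≤ n → cR n = -cE n) (hJ4 : ∀ n : ℕ, cJ4 n = 0)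
    (hcgh : ∀ n : ℕ, |cgh n| ≤ cgh₀) (hKray : ∀ n : ℕ, cK n = cgh n * (n : ℝ) ^ 2) (hQray : ∀ n : ℕ, cQ n = cgh n * a) (hx : ∀ n : ℕ, x₀ n = -cgh n)
    -- slot-table sockets (the END's), covariance, bond swap; `hdiv` (the ghost Ward rows `hrowgh` are a THEOREM on the ray: discharged inside)
    (hδW : ∀ n, 0 < δW n)
    (hE : ∀ n κ u l u', BiLoc (WE n κ u l u') u u' (CE n) (δW n)) (hJ : ∀ n κ u l u', BiLoc (WJ n κ u l u') u u' (CJ n) (δW n))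
    (hΛ : ∀ n κ u l u', BiLoc (WΛ n κ u l u') u u' (CΛt n) (δW n)) (hR : ∀ n κ u l u', BiLoc (WR n κ u l u') u u' (CRt n) (δW n))
    (hQ : ∀ n κ u l u', BiLoc (WQ n κ u l u') u u' (CQ n) (δW n))
    (hEc : ∀ (n : ℕ) (κ : Fin 4) (u : Site 4) (l : Fin 4) (u' t : Site 4),
      WE n κ (u + (n : ℤ) • t) l (u' + (n : ℤ) • t) = shiftK (-((n : ℤ) • t)) (WE n κ u l u'))
    (hJc : ∀ (n : ℕ) (κ : Fin 4) (u : Site 4) (l : Fin 4) (u' t : Site 4),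
      WJ n κ (u + (n : ℤ) • t) l (u' + (n : ℤ) • t) = shiftK (-((n : ℤ) • t)) (WJ n κ u l u'))
    (hΛc : ∀ (n : ℕ) (κ : Fin 4) (u : Site 4) (l : Fin 4) (u' t : Site 4),
      WΛ n κ (u + (n : ℤ) • t) l (u' + (n : ℤ) • t) = shiftK (-((n : ℤ) • t)) (WΛ n κ u l u'))
    (hRc : ∀ (n : ℕ) (κ : Fin 4) (u : Site 4) (l : Fin 4) (u' t : Site 4),
      WR n κ (u + (n : ℤ) • t) l (u' + (n : ℤ) • t) = shiftK (-((n : ℤ) • t)) (WR n κ u l u'))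
    (hQc : ∀ (n : ℕ) (κ : Fin 4) (u : Site 4) (l : Fin 4) (u' t : Site 4),
      WQ n κ (u + (n : ℤ) • t) l (u' + (n : ℤ) • t) = shiftK (-((n : ℤ) • t)) (WQ n κ u l u'))
    (hEs : ∀ n κ u l u', WE n κ u l u' = WE n l u' κ u) (hJs : ∀ n κ u l u', WJ n κ u l u' = WJ n l u' κ u)
    (hΛs : ∀ n κ u l u', WΛ n κ u l u' = WΛ n l u' κ u) (hRs : ∀ n κ u l u', WR n κ u l u' = WR n l u' κ u)
    (hQs : ∀ n κ u l u', WQ n κ u l u' = WQ n l u' κ u)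
    (hdiv : ∀ n : ℕ, 2 ≤ n → ∀ [NeZero n], ∀ (l' : Fin 4) (u' u : Site 4), ∑ κ' : Fin 4,
      (fineHess n a (SbfBal n a (cE n) (cVH n) (cΛ n) (cR n) (cK n) (cQ n))
          (Wbf (cE₂ n) (cJ4 n) (cΛ₂ n) (cR₂ n) (cQ₂ n) (WE n) (WJ n) (WΛ n) (WR n) (WQ n)) κ' l' (u - Pi.single κ' 1) u'
        - fineHess n a (SbfBal n a (cE n) (cVH n) (cΛ n) (cR n) (cK n) (cQ n))
          (Wbf (cE₂ n) (cJ4 n) (cΛ₂ n) (cR₂ n) (cQ₂ n) (WE n) (WJ n) (WΛ n) (WR n) (WQ n)) κ' l' u u') = 0)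
    -- (LOCAL) slot-E support and units; slot-R envelope and units (the three local ghost bubbles are SUPPLIED under reading (ii))
    {ρE : ℕ} {δ₀ kE : ℝ} (hδ₀ : 0 < δ₀) (hδE : ∀ n, δ₀ ≤ δW n)
    (hsuppE : ∀ n κ u l u', ρE < supNorm (u - u') → WE n κ u l u' = 0)
    (hkE : ∀ n : ℕ, 2 ≤ n → |ωgl n * cE₂ n| * CE n ≤ kE * (n : ℝ) ^ 8)
    {CwR δR : ℕ → ℝ} {θR δ₀R kR : ℝ} (hθR : 0 < θR) (hδR : ∀ n, 0 < δR n) (hδ₀R : 0 < δ₀R) (hδRge : ∀ n : ℕ, δ₀R / n ≤ δR n) (hCwR : ∀ n, 0 ≤ CwR n)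
    (hWRenv : ∀ n κ u l u', BiLoc (WR n κ u l u') u u' (CwR n * Real.exp (-(θR / n) * supNorm (u - u'))) (δR n))
    (hkR : ∀ n : ℕ, 2 ≤ n → |ωgl n * cR₂ n| * CwR n * (n : ℝ) ^ 6 ≤ kR)
    -- (Λ) sockets and zero-momentum data
    (hδT : ∀ n, 0 < δT n)
    (hdec : ∀ n : ℕ, 2 ≤ n → ∀ [NeZero n], ∀ κ u l u', WΛ n κ u l u' =
      (∑ m : Fin 4, OneStepResolventKernel.wsum (onLat n (fun y => lamCoeffOf (KInv (N := n) (d := 3)) n m y l u'))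
          (fun v => onLat n (fun y => TΛ n m y κ u) v))
      + (∑ m : Fin 4, OneStepResolventKernel.wsum (onLat n (fun y => lamCoeffOf (KInv (N := n) (d := 3)) n m y κ u))
          (fun v => onLat n (fun y => TΛ n m y l u') v))
      + WA n κ u l u')
    (hTloc : ∀ (n : ℕ) m y κ u, BiLoc (TΛ n m y κ u) ((n : ℤ) • y) ((n : ℤ) • y) (CT n * Real.exp (-δT n * l1 ((n : ℤ) • y - u))) (δT n))
    (hWAa : ∀ n κ u l u', trK (WA n κ u l u') = -WA n κ u l u') (hWAl : ∀ n κ u l u', Loc (WA n κ u l u'))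
    (hTcov : ∀ (n : ℕ) m y κ u t, TΛ n m (y + t) κ (u + (n : ℤ) • t) = shiftK (-((n : ℤ) • t)) (TΛ n m y κ u))
    (hcΛ : ∀ n : ℕ, 2 ≤ n → cΛ n ≠ 0) (hε : ∀ n : ℕ, ε n = 1 ∨ ε n = -1) (hδx : ∀ n, 0 < δx n) (hX : ∀ n u, BiLoc (X n u) u u (Cx n) (δx n))
    (hW1 : ∀ n : ℕ, 2 ≤ n → ∀ [NeZero n], ∀ u,
      comp (comp (Ga n a) (divV (fun κ v => ε n • SbfBal n a (cE n) (cVH n) (cΛ n) (cR n) (cK n) (cQ n) κ v) u)) (Ga n a) =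
        comp (Ga n a) (X n u) - comp (X n u) (Ga n a))
    (hW2 : ∀ n : ℕ, 2 ≤ n → ∀ [NeZero n], ∀ (m : Fin 4) (u : Site 4),
      divV (fun κ v => (-(ε n * (cΛ₂ n / cΛ n))) • TΛ n m 0 κ v) u = comp (X n u) (ffOf (hessFF n m 0)) - comp (ffOf (hessFF n m 0)) (X n u))
    -- (N) slot Q's SOCKETS (the (A2) readout of `WQ`: a decaying bi-localisation envelope at a BLOCK-scale rate floor and its units line — T₈ ⟸ `NeedleTadpoleRowDecay`)
    {CwQ δQ : ℕ → ℝ} {θQ δ₀Q kQ : ℝ} (hθQ : 0 < θQ) (hδQ : ∀ n, 0 < δQ n) (hδ₀Q : 0 < δ₀Q) (hδQge : ∀ n : ℕ, δ₀Q / n ≤ δQ n) (hCwQ : ∀ n, 0 ≤ CwQ n)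
    (hWQenv : ∀ n κ u l u', BiLoc (WQ n κ u l u') u u' (CwQ n * Real.exp (-(θQ / n) * supNorm (u - u'))) (δQ n))
    (hkQ : ∀ n : ℕ, 2 ≤ n → |ωgl n * cQ₂ n| * CwQ n * (n : ℝ) ^ 6 ≤ kQ)
    -- (U)
    (hU : ∀ n : ℕ, 2 ≤ n → ∀ u, |Ru u n| ≤ CU u) :
    D1Drift Lc Js N μ ν :=
  d1Drift_BFx_mean_of_D1Sum_dict_sbpS Js hμν hN hL hodd ha h12 h126 hall hθ0 hθ1 Jc hsum
    (hdictM_of_pointwise hL ha h12 h126 Jc hδW hE hJ hΛ hR hQ Rk hptw hMR hRuM) s hs hωs hlam hcE hRsgn hJ4 hcgh hKray hQray hx hδW hE hJ hΛ hR hQ hEc hJc hΛc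
    hRc hQc hEs hJs hΛs hRs hQs hdiv hδ₀ hδE hsuppE hkE hθR hδR hδ₀R hδRge hCwR hWRenv hkR hδT hdec hTloc hWAa hWAl hTcov hcΛ hε hδx hX hW1 hW2 hθQ hδQ hδ₀Q
    hδQge hCwQ hWQenv hkQ hU

/-- [folklore] **ROAD BF-x, MEAN LANE ⟹ THE SPINE's `D1Rep`, POINTWISE-DICTIONARY FORM, AT THE SPINE ROOT's OWN BINDER NAMES** — (E) §3
`d1Rep_BFx_mean_of_D1Tel_dict_sbpS` with `hdictM` ↦ `(Rk) (hptw) (hMR) (hRuM)`: the printed symmetries `hW`∕`hRfl` of the flipped step kernels and the spine's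
`htel : D1Tel Lc Js Jc` (literally the binders of `OneStepKernelFamily.d1Drift_of_D1Tel_D1Rep`) + the MEAN lane's list — `hall`∕`hθ0`∕`hθ1`, the pointwise dictionary
rows, sockets ∕ pins ∕ `h12`∕`h126`, `hSL`∕`k` — give the spine root's `hrep`; the mean-lane companion of the OWNER's (K1) §3 `RoadEndBFxDictPointwiseS.d1Rep_BFx_of_D1Tel_ptw_sbpS`
(his uniform rows `hRu`∕`hU₁` ↦ the Cesàro row `hRuM`, which they imply: `hRuM_of_uniform`; his lane has no `hall`).  HONEST: as §3's first theorem; `hW`∕`hRfl`∕`htel` are the spine's OPEN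
binders, displayed, not discharged. -/
theorem d1Rep_BFx_mean_of_D1Tel_ptw_sbpS (Js : ℕ → JetData 3 Lc) (hμν : μ ≠ ν) (hN : N ≠ 0) (hL : 2 ≤ Lc) (hodd : Odd Lc)
    (ha : 0 < a)
    (h12 : B5.Prop12Printed (fam nOf hn1 MOf a ha)) (h126 : B5.Kernel126_127Printed (kfam nOf MOf))
    -- MEAN grading: the displayed all-scales bound on the step coefficients (row G-an2-4) …
    (hall : AllScalesSeq (fun j => B12Beta.secondMoment (TbalOf Lc Js j) μ ν) κ θ) (hθ0 : 0 ≤ θ) (hθ1 : θ < 1)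
    -- … and, for bridge B1 in CESÀRO form: the spine's composite jet data, the Literature's read-out-level telescoping binder, and the CESÀRO one-shot (K)-estimate
    (Jc : ∀ m : ℕ, JetData 3 (Lc ^ m)) (hW : ∀ j, WardTransversal (flipK (TbalOf Lc Js j)))
    (hRfl : ∀ j, AxisReflectionCovariant (flipK (TbalOf Lc Js j))) (htel : D1Tel Lc Js Jc)
    -- THE (K) SLOT IN POINTWISE CURRENCY, MEAN FORM: rest-word kernels `Rk`, the pointwise dictionary `hptw` (the OWNER's, letter for letter), the rest kernels'
    -- moments, and their read-out slack IN CESÀRO CURRENCY `hRuM`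
    (Rk : υ → ℕ → Fin 4 → Fin 4 → Site 4 → ℝ)
    (hptw : ∀ m : ℕ, 1 ≤ m → ∀ z : Site 4, TshotOf Lc Jc m μ ν z =
      ωgl (Lc ^ m) * TOfRed (Lc ^ m) a
          (SbfBal (Lc ^ m) a (cE (Lc ^ m)) (cVH (Lc ^ m)) (cΛ (Lc ^ m)) (cR (Lc ^ m)) (cK (Lc ^ m)) (cQ (Lc ^ m)))
          (tableRed (Lc ^ m) (Wbf (cE₂ (Lc ^ m)) (cJ4 (Lc ^ m)) (cΛ₂ (Lc ^ m)) (cR₂ (Lc ^ m)) (cQ₂ (Lc ^ m))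
            (WE (Lc ^ m)) (WJ (Lc ^ m)) (WΛ (Lc ^ m)) (WR (Lc ^ m)) (WQ (Lc ^ m)))) μ ν z
        + ωgh (Lc ^ m) * PghQ (Lc ^ m) a (x₀ (Lc ^ m)) (cK (Lc ^ m)) (cQ (Lc ^ m)) μ ν z
        + ∑ u, Rk u (Lc ^ m) μ ν z)
    (hMR : ∀ (u : υ) (m : ℕ), 1 ≤ m → AbsMoment₂ (Rk u (Lc ^ m) μ ν))
    (hRuM : ∀ u : υ, Tendsto (fun m : ℕ => (B12Beta.secondMoment (Rk u (Lc ^ m)) μ ν - Ru u (Lc ^ m)) / (m : ℝ)) atTop (𝓝 0))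
    -- the RESCALED loop-weight tie of reading (ii): displayed scalar family `s`, pinned `s n = n⁻²`; the normalisation
    (s : ℕ → ℝ) (hs : ∀ n : ℕ, 2 ≤ n → s n = ((n : ℝ) ^ 2)⁻¹) (hωs : ∀ n : ℕ, 2 ≤ n → ωgh n * (s n * cK n) ^ 2 = -2 * (ωgl n * cE n ^ 2))
    (hlam : ∀ n : ℕ, 2 ≤ n → ωgl n * cE n ^ 2 = 2 * N ^ 2 * (n : ℝ) ^ 8)
    -- pins and the ray (the rows' letters)
    (hcE : ∀ n : ℕ, 2 ≤ n → cE n = (n : ℝ) ^ 4) (hRsgn : ∀ n : ℕ, 2 ≤ n → cR n = -cE n) (hJ4 : ∀ n : ℕ, cJ4 n = 0)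
    (hcgh : ∀ n : ℕ, |cgh n| ≤ cgh₀) (hKray : ∀ n : ℕ, cK n = cgh n * (n : ℝ) ^ 2) (hQray : ∀ n : ℕ, cQ n = cgh n * a) (hx : ∀ n : ℕ, x₀ n = -cgh n)
    -- slot-table sockets (the END's), covariance, bond swap; `hdiv` (the ghost Ward rows `hrowgh` are a THEOREM on the ray: discharged inside)
    (hδW : ∀ n, 0 < δW n)
    (hE : ∀ n κ u l u', BiLoc (WE n κ u l u') u u' (CE n) (δW n)) (hJ : ∀ n κ u l u', BiLoc (WJ n κ u l u') u u' (CJ n) (δW n))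
    (hΛ : ∀ n κ u l u', BiLoc (WΛ n κ u l u') u u' (CΛt n) (δW n)) (hR : ∀ n κ u l u', BiLoc (WR n κ u l u') u u' (CRt n) (δW n))
    (hQ : ∀ n κ u l u', BiLoc (WQ n κ u l u') u u' (CQ n) (δW n))
    (hEc : ∀ (n : ℕ) (κ : Fin 4) (u : Site 4) (l : Fin 4) (u' t : Site 4),
      WE n κ (u + (n : ℤ) • t) l (u' + (n : ℤ) • t) = shiftK (-((n : ℤ) • t)) (WE n κ u l u'))
    (hJc : ∀ (n : ℕ) (κ : Fin 4) (u : Site 4) (l : Fin 4) (u' t : Site 4),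
      WJ n κ (u + (n : ℤ) • t) l (u' + (n : ℤ) • t) = shiftK (-((n : ℤ) • t)) (WJ n κ u l u'))
    (hΛc : ∀ (n : ℕ) (κ : Fin 4) (u : Site 4) (l : Fin 4) (u' t : Site 4),
      WΛ n κ (u + (n : ℤ) • t) l (u' + (n : ℤ) • t) = shiftK (-((n : ℤ) • t)) (WΛ n κ u l u'))
    (hRc : ∀ (n : ℕ) (κ : Fin 4) (u : Site 4) (l : Fin 4) (u' t : Site 4),
      WR n κ (u + (n : ℤ) • t) l (u' + (n : ℤ) • t) = shiftK (-((n : ℤ) • t)) (WR n κ u l u'))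
    (hQc : ∀ (n : ℕ) (κ : Fin 4) (u : Site 4) (l : Fin 4) (u' t : Site 4),
      WQ n κ (u + (n : ℤ) • t) l (u' + (n : ℤ) • t) = shiftK (-((n : ℤ) • t)) (WQ n κ u l u'))
    (hEs : ∀ n κ u l u', WE n κ u l u' = WE n l u' κ u) (hJs : ∀ n κ u l u', WJ n κ u l u' = WJ n l u' κ u)
    (hΛs : ∀ n κ u l u', WΛ n κ u l u' = WΛ n l u' κ u) (hRs : ∀ n κ u l u', WR n κ u l u' = WR n l u' κ u)
    (hQs : ∀ n κ u l u', WQ n κ u l u' = WQ n l u' κ u)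
    (hdiv : ∀ n : ℕ, 2 ≤ n → ∀ [NeZero n], ∀ (l' : Fin 4) (u' u : Site 4), ∑ κ' : Fin 4,
      (fineHess n a (SbfBal n a (cE n) (cVH n) (cΛ n) (cR n) (cK n) (cQ n))
          (Wbf (cE₂ n) (cJ4 n) (cΛ₂ n) (cR₂ n) (cQ₂ n) (WE n) (WJ n) (WΛ n) (WR n) (WQ n)) κ' l' (u - Pi.single κ' 1) u'
        - fineHess n a (SbfBal n a (cE n) (cVH n) (cΛ n) (cR n) (cK n) (cQ n))
          (Wbf (cE₂ n) (cJ4 n) (cΛ₂ n) (cR₂ n) (cQ₂ n) (WE n) (WJ n) (WΛ n) (WR n) (WQ n)) κ' l' u u') = 0)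
    -- (LOCAL) slot-E support and units; slot-R envelope and units (the three local ghost bubbles are SUPPLIED under reading (ii))
    {ρE : ℕ} {δ₀ kE : ℝ} (hδ₀ : 0 < δ₀) (hδE : ∀ n, δ₀ ≤ δW n)
    (hsuppE : ∀ n κ u l u', ρE < supNorm (u - u') → WE n κ u l u' = 0)
    (hkE : ∀ n : ℕ, 2 ≤ n → |ωgl n * cE₂ n| * CE n ≤ kE * (n : ℝ) ^ 8)
    {CwR δR : ℕ → ℝ} {θR δ₀R kR : ℝ} (hθR : 0 < θR) (hδR : ∀ n, 0 < δR n) (hδ₀R : 0 < δ₀R) (hδRge : ∀ n : ℕ, δ₀R / n ≤ δR n) (hCwR : ∀ n, 0 ≤ CwR n)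
    (hWRenv : ∀ n κ u l u', BiLoc (WR n κ u l u') u u' (CwR n * Real.exp (-(θR / n) * supNorm (u - u'))) (δR n))
    (hkR : ∀ n : ℕ, 2 ≤ n → |ωgl n * cR₂ n| * CwR n * (n : ℝ) ^ 6 ≤ kR)
    -- (Λ) sockets and zero-momentum data
    (hδT : ∀ n, 0 < δT n)
    (hdec : ∀ n : ℕ, 2 ≤ n → ∀ [NeZero n], ∀ κ u l u', WΛ n κ u l u' =
      (∑ m : Fin 4, OneStepResolventKernel.wsum (onLat n (fun y => lamCoeffOf (KInv (N := n) (d := 3)) n m y l u'))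
          (fun v => onLat n (fun y => TΛ n m y κ u) v))
      + (∑ m : Fin 4, OneStepResolventKernel.wsum (onLat n (fun y => lamCoeffOf (KInv (N := n) (d := 3)) n m y κ u))
          (fun v => onLat n (fun y => TΛ n m y l u') v))
      + WA n κ u l u')
    (hTloc : ∀ (n : ℕ) m y κ u, BiLoc (TΛ n m y κ u) ((n : ℤ) • y) ((n : ℤ) • y) (CT n * Real.exp (-δT n * l1 ((n : ℤ) • y - u))) (δT n))
    (hWAa : ∀ n κ u l u', trK (WA n κ u l u') = -WA n κ u l u') (hWAl : ∀ n κ u l u', Loc (WA n κ u l u'))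
    (hTcov : ∀ (n : ℕ) m y κ u t, TΛ n m (y + t) κ (u + (n : ℤ) • t) = shiftK (-((n : ℤ) • t)) (TΛ n m y κ u))
    (hcΛ : ∀ n : ℕ, 2 ≤ n → cΛ n ≠ 0) (hε : ∀ n : ℕ, ε n = 1 ∨ ε n = -1) (hδx : ∀ n, 0 < δx n) (hX : ∀ n u, BiLoc (X n u) u u (Cx n) (δx n))
    (hW1 : ∀ n : ℕ, 2 ≤ n → ∀ [NeZero n], ∀ u,
      comp (comp (Ga n a) (divV (fun κ v => ε n • SbfBal n a (cE n) (cVH n) (cΛ n) (cR n) (cK n) (cQ n) κ v) u)) (Ga n a) =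
        comp (Ga n a) (X n u) - comp (X n u) (Ga n a))
    (hW2 : ∀ n : ℕ, 2 ≤ n → ∀ [NeZero n], ∀ (m : Fin 4) (u : Site 4),
      divV (fun κ v => (-(ε n * (cΛ₂ n / cΛ n))) • TΛ n m 0 κ v) u = comp (X n u) (ffOf (hessFF n m 0)) - comp (ffOf (hessFF n m 0)) (X n u))
    -- (N) slot Q's SOCKETS (the (A2) readout of `WQ`: a decaying bi-localisation envelope at a BLOCK-scale rate floor and its units line — T₈ ⟸ `NeedleTadpoleRowDecay`)
    {CwQ δQ : ℕ → ℝ} {θQ δ₀Q kQ : ℝ} (hθQ : 0 < θQ) (hδQ : ∀ n, 0 < δQ n) (hδ₀Q : 0 < δ₀Q) (hδQge : ∀ n : ℕ, δ₀Q / n ≤ δQ n) (hCwQ : ∀ n, 0 ≤ CwQ n)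
    (hWQenv : ∀ n κ u l u', BiLoc (WQ n κ u l u') u u' (CwQ n * Real.exp (-(θQ / n) * supNorm (u - u'))) (δQ n))
    (hkQ : ∀ n : ℕ, 2 ≤ n → |ωgl n * cQ₂ n| * CwQ n * (n : ℝ) ^ 6 ≤ kQ)
    -- (U)
    (hU : ∀ n : ℕ, 2 ≤ n → ∀ u, |Ru u n| ≤ CU u)
    -- base-point labels of the free one-shot side (the spine root's `hSL` ∕ `k`); the Literature's window data is discharged at `M := id`, `cc := 1` (the owner's `window_id`)
    {L : Type*} {SL : Finset L} (hSL : SL.Nonempty) (k : L → Fin 4) :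
    D1Rep Lc Jc N μ ν a SL k :=
  d1Rep_BFx_mean_of_D1Tel_dict_sbpS Js hμν hN hL hodd ha h12 h126 hall hθ0 hθ1 Jc hW hRfl htel
    (hdictM_of_pointwise hL ha h12 h126 Jc hδW hE hJ hΛ hR hQ Rk hptw hMR hRuM) s hs hωs hlam hcE hRsgn hJ4 hcgh hKray hQray hx hδW hE hJ hΛ hR hQ hEc hJc hΛc
    hRc hQc hEs hJs hΛs hRs hQs hdiv hδ₀ hδE hsuppE hkE hθR hδR hδ₀R hδRge hCwR hWRenv hkR hδT hdec hTloc hWAa hWAl hTcov hcΛ hε hδx hX hW1 hW2 hθQ hδQ hδ₀Q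
    hδQge hCwQ hWQenv hkQ hU hSL k

end Summit.QuantumFields.BalabanUV.Beta.D1BFx.RoadEndBFxDictPointwiseMeanS

end
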